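import Literature.AlgebraicGeometry.Resolution.NeronPopescuDesingularizationLemma
import Literature.AlgebraicGeometry.Resolution.StrictlyStandardBaseChange
import Mathlib.RingTheory.Smooth.Flat
import Mathlib.RingTheory.TensorProduct.Basic
import Mathlib.RingTheory.FinitePresentation
import Mathlib.RingTheory.Ideal.Quotient.Operations
import HarnessLib

/-!
# Stacks 07CT (the desingularization lemma for a pair `A, D`), for `D` smooth over `R`

Topic: `Literature/AlgebraicGeometry/Resolution`. The Stacks Project, *Smoothing Ring Maps*
(Tag 07BW), §16.7:

> **Lemma 07CT.** Let `R` be a Noetherian ring. Let `Λ` be an `R`-algebra. Let `π ∈ R` and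
> assume that `Ann_R(π) = Ann_R(π²)` and `Ann_Λ(π) = Ann_Λ(π²)`. Let `A → Λ` and `D → Λ` be
> `R`-algebra maps with `A` and `D` of finite presentation. Assume (1) `π` is strictly standard
> in `A` over `R`, and (2) there exists an `R`-algebra map `A/π⁴A → D/π⁴D` compatible with the
> maps to `Λ/π⁴Λ`. Then we can find an `R`-algebra map `B → Λ` with `B` of finite presentation
> and `R`-algebra maps `A → B` and `D → B` compatible with the maps to `Λ` such that
> `H_{D/R}B ⊂ H_{B/D}` and `H_{D/R}B ⊂ H_{B/R}`.
>
> *Proof.* We apply Lemma 07CR to `D → A ⊗_R D → Λ` and the image of `π` in `D`. By Lemma 07CC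
> we see that `π` is strictly standard in `A ⊗_R D` over `D`. As our section
> `ρ : (A ⊗_R D)/π⁴(A ⊗_R D) → D/π⁴D` we take the map induced by the map in (2). Thus Lemma 07CR
> applies and we obtain a factorization `A ⊗_R D → B → Λ` with `B` of finite presentation and
> `𝔞B ⊂ H_{B/D}` where `𝔞 = Ann_D(Ann_D(π²)/Ann_D(π))`. For any prime `𝔮` of `D` such that `D_𝔮`
> is flat over `R` we have `Ann_{D_𝔮}(π²)/Ann_{D_𝔮}(π) = 0` because annihilators of elements
> commutes with flat base change and we assumed `Ann_R(π) = Ann_R(π²)`. … The final inclusion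
> `H_{D/R}B ⊂ H_{B/R}` follows because compositions of smooth ring maps are smooth.

This file PROVES the lemma in the case used by the proof of Lemma 07F5 ("Since `D` is smooth over
`R`, `H_{D/R} = D`"): **`D` smooth over `R`**, in the exact form of hypothesis `hCT` of
`Stacks07F5_reduceToField_of_smooth` (`NeronPopescuReduceToField.lean`) —
`Stacks07CT_of_smooth`. Following the printed proof: `π` is strictly standard in `D ⊗_R A` over
`D` (Lemma 07CC, `IsStrictlyStandard.baseChange`, `StrictlyStandardBaseChange.lean`); the section
`(D ⊗_R A)/π⁴ → D/π⁴D` is induced by the map in (2); `D` is smooth, hence flat, over `R`, so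
`Ann_D(π) = Ann_D(π²)` globally (annihilators commute with flat base change,
`Stacks07CR.pi_mul_eq_zero_of_sq`) and the ideal `𝔞` is all of `D`; `D` is Noetherian (finitely
presented over the Noetherian `R`); Lemma 07CR (`Stacks07CR_desingularization`,
`NeronPopescuDesingularizationLemma.lean`) over `D` then gives `D ⊗_R A → B → Λ` with
`1 ∈ H_{B/D}`, i.e. `B` smooth over `D`, hence over `R` (composition), so that
`H_{B/R} = B ⊇ H_{D/R}B`.

## References

* The Stacks Project, *Smoothing Ring Maps* (Tag 07BW): Lemma 07CT and its proof; Lemmas 07CR,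
  07CC. [StacksProject]
-/

noncomputable section

open TensorProduct

namespace Literature.AlgebraicGeometry.Resolution

universe u

/-- **Stacks, Lemma 07CT (desingularization), for `D` smooth over `R`** — hypothesis `hCT` of
`Stacks07F5_reduceToField_of_smooth` verbatim (the Noetherian, annihilator and finite presentation
hypotheses are those of 07CT; `Algebra.Smooth R D` is the extra assumption of the case used in
Lemma 07F5). Proof as printed, through Lemma 07CR over the base `D` applied to
`D → D ⊗_R A → Λ`: `π` is strictly standard in `D ⊗_R A` over `D` by Lemma 07CC, the section is
induced by the map in (2), `Ann_D(π) = Ann_D(π²)` because `D` is flat over `R`, so `𝔞 = D` and the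
algebra `B` of 07CR is smooth over `D`, hence over `R`, whence `H_{B/R} = B ⊇ H_{D/R}B`.
[cite: StacksProject, Tag 07CT] -/
theorem Stacks07CT_of_smooth :
    ∀ (R Λ : Type u) [CommRing R] [CommRing Λ] [Algebra R Λ] (π : R),
      IsNoetherianRing R →
      (∀ r : R, π ^ 2 * r = 0 → π * r = 0) →
      (∀ x : Λ, algebraMap R Λ π ^ 2 * x = 0 → algebraMap R Λ π * x = 0) →
      ∀ (A D : Type u) [CommRing A] [CommRing D] [Algebra R A] [Algebra R D],
        Algebra.FinitePresentation R A → Algebra.FinitePresentation R D → Algebra.Smooth R D →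
      ∀ (α : A →ₐ[R] Λ) (δ : D →ₐ[R] Λ), IsStrictlyStandard R (algebraMap R A π) →
      ∀ (ρ : (A ⧸ (Ideal.span {π ^ 4}).map (algebraMap R A)) →ₐ[R]
          (D ⧸ (Ideal.span {π ^ 4}).map (algebraMap R D))),
        (∀ (a : A) (d : D), Ideal.Quotient.mk _ d = ρ (Ideal.Quotient.mk _ a) →
          Ideal.Quotient.mk ((Ideal.span {π ^ 4}).map (algebraMap R Λ)) (δ d) =
            Ideal.Quotient.mk ((Ideal.span {π ^ 4}).map (algebraMap R Λ)) (α a)) →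
      ∃ (B : Type u) (_ : CommRing B) (_ : Algebra R B), Algebra.FinitePresentation R B ∧
        ∃ (β : B →ₐ[R] Λ) (i : A →ₐ[R] B) (j : D →ₐ[R] B),
          β.comp i = α ∧ β.comp j = δ ∧ (singularIdeal R D).map j ≤ singularIdeal R B := by
  intro R Λ _ _ _ π hN hR hΛ A D _ _ _ _ _ _ hD α δ hπ ρ hρ
  haveI := hN
  haveI := hD
  -- `D` is Noetherian
  haveI : IsNoetherianRing D := Algebra.FiniteType.isNoetherianRing R D
  -- `Λ` as a `D`-algebra through `δ`
  letI : Algebra D Λ := δ.toRingHom.toAlgebra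
  haveI : IsScalarTower R D Λ := IsScalarTower.of_algebraMap_eq fun r => (δ.commutes r).symm
  have hδ : ∀ d : D, algebraMap D Λ d = δ d := fun d => rfl
  set πD : D := algebraMap R D π with hπD
  -- `Ann_D(π) = Ann_D(π²)`: annihilators commute with the flat base change `R → D`
  have hRD : ∀ d : D, πD ^ 2 * d = 0 → πD * d = 0 := fun d hd =>
    Stacks07CR.pi_mul_eq_zero_of_sq π (r₀ := 1) (fun s hs => by rw [one_mul]; exact hR s hs)
      (by rw [map_one]; exact isUnit_one) d hd
  have hΛD : ∀ x : Λ, algebraMap D Λ πD ^ 2 * x = 0 → algebraMap D Λ πD * x = 0 := by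
    intro x hx
    rw [hπD, ← IsScalarTower.algebraMap_apply] at hx ⊢
    exact hΛ x hx
  -- `D ⊗_R A → Λ`
  let φD : D ⊗[R] A →ₐ[D] Λ := Algebra.TensorProduct.lift (Algebra.ofId D Λ) α fun _ _ => Commute.all _ _
  have hφD : ∀ (d : D) (a : A), φD (d ⊗ₜ a) = δ d * α a := fun d a => by
    rw [Algebra.TensorProduct.lift_tmul, Algebra.ofId_apply, hδ]
  -- `π` strictly standard in `D ⊗_R A` over `D` (07CC)
  have hπD' : IsStrictlyStandard D (algebraMap D (D ⊗[R] A) πD) := by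
    have h := hπ.baseChange D
    rwa [show ((1 : D) ⊗ₜ[R] algebraMap R A π : D ⊗[R] A) = algebraMap D (D ⊗[R] A) πD by
      rw [hπD, ← IsScalarTower.algebraMap_apply R D (D ⊗[R] A),
        ← Algebra.TensorProduct.includeRight_apply, AlgHom.commutes]] at h
  haveI : Algebra.FinitePresentation D (D ⊗[R] A) := hπD'.finitePresentation
  -- the ideals `π⁴ D`, `π⁴ Λ`
  have hDeq : (Ideal.span {π ^ 4}).map (algebraMap R D) = Ideal.span {πD ^ 4} := by
    rw [Ideal.map_span, Set.image_singleton, map_pow]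
  have hΛeq : Ideal.span {algebraMap D Λ πD ^ 4} = (Ideal.span {π ^ 4}).map (algebraMap R Λ) := by
    rw [Ideal.map_span, Set.image_singleton, map_pow, hπD, ← IsScalarTower.algebraMap_apply]
  -- the section `ρ_D : (D ⊗ A)/π⁴ → D/π⁴D` induced by `ρ`
  let ρ' : (A ⧸ (Ideal.span {π ^ 4}).map (algebraMap R A)) →ₐ[R] D ⧸ Ideal.span {πD ^ 4} :=
    (Ideal.quotientEquivAlgOfEq R hDeq).toAlgHom.comp ρ
  have hρ' : ∀ (a : A) (d : D), Ideal.Quotient.mk _ d = ρ (Ideal.Quotient.mk _ a) →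
      ρ' (Ideal.Quotient.mk _ a) = Ideal.Quotient.mk _ d := by
    intro a d h
    change Ideal.quotientEquivAlgOfEq R hDeq (ρ (Ideal.Quotient.mk _ a)) = _
    rw [← h, Ideal.quotientEquivAlgOfEq_mk]
  let ρ₀ : D ⊗[R] A →ₐ[D] D ⧸ Ideal.span {πD ^ 4} :=
    Algebra.TensorProduct.lift (Ideal.Quotient.mkₐ D (Ideal.span {πD ^ 4}))
      (ρ'.comp (Ideal.Quotient.mkₐ R ((Ideal.span {π ^ 4}).map (algebraMap R A)))) fun _ _ => Commute.all _ _
  have hρ₀ : ∀ (d : D) (a : A), ρ₀ (d ⊗ₜ a) = Ideal.Quotient.mk _ d * ρ' (Ideal.Quotient.mk _ a) :=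
    fun d a => by rw [Algebra.TensorProduct.lift_tmul]; rfl
  let ρD : (D ⊗[R] A ⧸ Ideal.span {algebraMap D (D ⊗[R] A) πD ^ 4}) →ₐ[D] D ⧸ Ideal.span {πD ^ 4} :=
    Ideal.Quotient.liftₐ _ ρ₀ (by
      intro x hx
      obtain ⟨y, rfl⟩ := Ideal.mem_span_singleton'.mp hx
      have h1 : (Ideal.Quotient.mk (Ideal.span {πD ^ 4}) πD) ^ 4 =
          Ideal.Quotient.mk (Ideal.span {πD ^ 4}) (πD ^ 4) := (map_pow _ _ _).symm
      have h0 : ρ₀ (algebraMap D (D ⊗[R] A) πD ^ 4) = 0 := by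
        rw [map_pow, AlgHom.commutes, Ideal.Quotient.algebraMap_eq, h1]
        exact Ideal.Quotient.eq_zero_iff_mem.mpr (Ideal.mem_span_singleton_self _)
      rw [map_mul, h0, mul_zero])
  have hρD_mk : ∀ x : D ⊗[R] A, ρD (Ideal.Quotient.mk _ x) = ρ₀ x := fun x => rfl
  -- compatibility of `ρ_D` with the maps to `Λ/π⁴Λ`
  let JΛ : Ideal Λ := Ideal.span {algebraMap D Λ πD ^ 4}
  have hθle : Ideal.span {πD ^ 4} ≤ JΛ.comap (Algebra.ofId D Λ) := by
    rw [Ideal.span_singleton_le_iff_mem, Ideal.mem_comap, Algebra.ofId_apply, map_pow]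
    exact Ideal.mem_span_singleton_self _
  let θ : (D ⧸ Ideal.span {πD ^ 4}) →ₐ[D] Λ ⧸ JΛ := Ideal.quotientMapₐ JΛ (Algebra.ofId D Λ) hθle
  have hθ : ∀ d : D, θ (Ideal.Quotient.mk _ d) = Ideal.Quotient.mk JΛ (δ d) := fun d => rfl
  have hsq : (Ideal.Quotient.mkₐ D JΛ).comp φD =
      θ.comp (ρD.comp (Ideal.Quotient.mkₐ D (Ideal.span {algebraMap D (D ⊗[R] A) πD ^ 4}))) := by
    refine Algebra.TensorProduct.ext' fun d a => ?_
    obtain ⟨d', hd'⟩ := Ideal.Quotient.mk_surjective (ρ (Ideal.Quotient.mk _ a))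
    rw [AlgHom.comp_apply, AlgHom.comp_apply, AlgHom.comp_apply, Ideal.Quotient.mkₐ_eq_mk,
      Ideal.Quotient.mkₐ_eq_mk, hφD, hρD_mk, hρ₀, hρ' a d' hd', map_mul, map_mul, hθ, hθ]
    congr 1
    have h := hρ a d' hd'
    rw [Ideal.Quotient.mk_eq_mk_iff_sub_mem] at h ⊢
    change α a - δ d' ∈ Ideal.span {algebraMap D Λ πD ^ 4}
    rw [hΛeq, ← neg_sub, Ideal.neg_mem_iff]
    exact h
  have hρD : ∀ (x : D ⊗[R] A) (d : D), ρD (Ideal.Quotient.mk _ x) = Ideal.Quotient.mk _ d →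
      φD x - algebraMap D Λ d ∈ Ideal.span {algebraMap D Λ πD ^ 4} := by
    intro x d h
    have h1 := AlgHom.congr_fun hsq x
    rw [AlgHom.comp_apply, Ideal.Quotient.mkₐ_eq_mk, AlgHom.comp_apply, AlgHom.comp_apply,
      Ideal.Quotient.mkₐ_eq_mk, h, hθ, ← hδ] at h1
    exact (Ideal.Quotient.mk_eq_mk_iff_sub_mem _ _).mp h1
  -- Lemma 07CR over `D`
  obtain ⟨B, _, _, f, g, hBfp, hgf, hsing⟩ := Stacks07CR_desingularization πD hΛD φD hπD' ρD hρD
  haveI := hBfp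
  -- `𝔞 = D`: `1 ∈ H_{B/D}`, i.e. `B` is smooth over `D`
  have hBD : Algebra.Smooth D B := by
    refine singularIdeal_eq_top_iff.mp ?_
    rw [Ideal.eq_top_iff_one, ← (algebraMap D B).map_one]
    exact hsing 1 fun s hs => by rw [one_mul]; exact hRD s hs
  -- `B` as an `R`-algebra: smooth over `R`
  letI : Algebra R B := ((algebraMap D B).comp (algebraMap R D)).toAlgebra
  haveI : IsScalarTower R D B := IsScalarTower.of_algebraMap_eq fun _ => rfl
  haveI := hBD
  haveI : Algebra.Smooth R B := Algebra.Smooth.comp R D B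
  refine ⟨B, inferInstance, inferInstance, inferInstance, g.restrictScalars R,
    (f.restrictScalars R).comp (Algebra.TensorProduct.includeRight (R := R) (A := D) (B := A)),
    IsScalarTower.toAlgHom R D B, ?_, ?_, ?_⟩
  · refine AlgHom.ext fun a => ?_
    rw [AlgHom.comp_apply, AlgHom.comp_apply, AlgHom.restrictScalars_apply, AlgHom.restrictScalars_apply,
      Algebra.TensorProduct.includeRight_apply, hgf, hφD, map_one, one_mul]
  · refine AlgHom.ext fun d => ?_
    rw [AlgHom.comp_apply, AlgHom.restrictScalars_apply, IsScalarTower.coe_toAlgHom', AlgHom.commutes, hδ]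
  · rw [singularIdeal_eq_top_of_smooth (R := R) (A := B)]
    exact le_top

end Literature.AlgebraicGeometry.Resolution
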